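import Literature.MathematicalPhysics.QuantumFieldTheory.Balaban1983to89.B11Eq72Concrete
import Literature.MathematicalPhysics.QuantumFieldTheory.Balaban1983to89.B6Lemma21Bridge

/-!
# `Balaban1983to89.B11Eq71KernelConcrete` — T. Bałaban, *The variational problem and background fields in renormalization group method
for lattice gauge theories*, Commun. Math. Phys. **102** (1985) 277–309 [Balaban1985Variational], (69) p. 288 and (71) p. 289 AT KERNEL LEVEL
FOR THE CONCRETE REMAINDER `C_j(U₀, ·)` OF [4] ON THE `ℤᵈ` CARRIER: **«the operator … is of the same type as the operators R studied in [3, 5].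
Let us denote it by ℜ» (69) and «|(I + ℜ)⁻¹(c, c′)| ≦ (1 − 9C₂B₀ε₃dc₁(½))⁻¹(L^{j′}η)^{−d}e^{−(1/2)δ₀d(c₋,c′₋)} ≦ 2(L^{j′}η)^{−d}
e^{−(1/2)δ₀d(c₋,c′₋)} … which follows from Lemma 2.1 [3]» (71), WITH THE EXPONENTIAL DECAY**, from the kernel decay of `H` ([5] Theorem
3.12, hypothesis) and Lemma 2.1 of [3] (the single-scale row sum `B6Lemma21TwoScale.singleScale_row_sum`, BY NAME) — the decay that
`B11Eq73KernelDecay` (abstract kernels over `B6.Geometry`) assumes as `h71` and that `B11Prop3Model`/`B11Prop3Concrete` replace by the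
NORM-LEVEL reading (M6) `‖(I + ℜ)⁻¹‖ ≤ 2`; sequel `B11Eq73KernelConcrete` = (73) with its decay

statement-level skeleton of published theorems with citation tags; proofs where landed; nothing here is a claim about the Yang–Mills mass gap

v1.1 (p06 gen 17, 2026-08-22): DOCFIX ONLY — the «THE PRINT (pp. 288–289)» quotation below re-typed VERBATIM from the page (renders
`…-p012-x2.png` / `…-p013-x2.png`, text layer `p0012.txt` L7–8, L22–31, `p0013.txt` L2–8): v1 carried connective prose of ours («Differentiating
Eq. (49) we get …», «The operator in the square brackets above has the kernel … thus it can be estimated by …») inside the guillemets — r08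
`QUOTE-AUDIT-B11.md` §E item R1; declarations byte-identical.

PDF held: `paper:balaban1985-cmp102-variational-background` (journal page = PDF page + 276); pp. 288–289 [PDF 12–13], render
`run/shared/lean/pub/pub-balaban/b2b-balaban-ref1/pages/1985-cmp102-variational-background/…-p013-x2.png` read as image by this seat
(2026-08-21); [3] = [Balaban1984PropagatorsII] Lemma 2.1 (2.61) p. 234, (2.54) p. 233; [4] = [Balaban1985Averaging] (141), (149), (157);
[5] = [Balaban1985BackgroundPropagators] Thm 3.12.

CITATION HEADER / WHAT IS REPRODUCED.  Cell `lit-balaban`, Phase-2 proof seat p06 gen 7 = unit `lit-balaban-p06` (TAKING line HOME/STATUS.md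
2026-08-21, gen 7); SKELETON rows **B11.Eq63** ((63)–(69): (69) is the kernel bound of `ℜ`), **B11.Eq70** ((70)–(71)); owner r08
(`B11Eq63FunctionalDerivative.ineq69` = the Cauchy step (69) column by column, abstract; `B11SectG.neumann_majorant` = the majorant form of (71) over
abstract block norms; p06's `B11Eq70Concrete` = (68)/(70) and `‖ℜ‖ < 1` for the concrete `C_j`, `B11Eq72Concrete` = (72) with the locality of the
kernel of `(δC_j/δA)`).  THE PRINT (pp. 288–289, after (64); «…» marks the elided displays (65)–(67) and the three elided middle members of
(69), nothing else): *«We will prove that this function has an exponential decay. It satisfies an integral equation which can be obtained by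
differentiation of Eq. (49): … (65) hence … (66) where we have suppressed matrix indices of operators acting on the Lie algebra valued
functions. We may write this equation in the form … (67) This gives the following equation on 𝔇:
[I + Lʲη⟨(δC_j/δA)(Lʲη(A′ − HD(A′))), H⟩]𝔇(A′) = Lʲη(δC_j/δA)(Lʲη(A′ − HD(A′))) on Λ_j. (68) As it is easily seen from (66) this equation is
an equation on 𝔇 as a function of the variable c ∈ 𝔅_k. The variable b is fixed and treated as a parameter. We have the bound
|(Lʲη⟨(δC_j/δA)(Lʲη(A′ − HD(A′))), H⟩)(c, c′)| = … ≦ (1/r)C₂(2ε₃ + rB₀(L^{j′}η)^{−d}e^{−δ₀d(c₋,c′₋)})² = 9C₂B₀ε₃(L^{j′}η)^{−d}e^{−δ₀d(c₋,c′₋)}, (69)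
where we have taken r = ε₃(B₀(L^{j′}η)^{−d}e^{−δ₀d(c₋,c′₋)})⁻¹, c ∈ Λ_j, c′ ∈ Λ_{j′}, (see [3] for a definition of the distance d(y, y′),
y, y′ ∈ 𝔅_k). The above bound shows that the operator in the square bracket in (68) (without the identity operator) is of the same type as
the operators R studied in [3, 5]. Let us denote it by ℜ. Equation (68) is uniquely solvable by a convergent Neumann series,
𝔇(A′) = (I + ℜ)⁻¹L^{j(·)}η((δ/δA)C)(A′ − HD(A′)), (70) where j(c) = j for c ∈ Λ_j, and C(A, c) = C_j(LʲηA, c) for c ∈ Λ_j. A kernel of the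
operator (I + ℜ)⁻¹ satisfies the bound |(I + ℜ)⁻¹(c, c′)| ≦ (1 − 9C₂B₀ε₃dc₁(½))⁻¹(L^{j′}η)^{−d}e^{−(1/2)δ₀d(c₋,c′₋)} ≦
2(L^{j′}η)^{−d}e^{−(1/2)δ₀d(c₋,c′₋)} (71) for ε₃ sufficiently small, which follows from Lemma 2.1 [3].»*; (46) p. 285 *«the Theorem 3.12
from [5] implies |HB| ≦ B₀(Lʲη)⁻¹|B|»*.

DICTIONARY (as `B11Eq70Concrete` / `B11Eq72Concrete`: ONE scale `j`, tree units, sup norms; `Cmap a = (C_j(U₀, ins_S a)(c))_{c∈T}`, coarse bonds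
`c = (z, κ) ∈ T` with `z ∈ ℤᵈ` the block index of `c₋` (`B7Prop1Local.loK`: `c₋ = Lʲz` on the fine lattice), fine bonds `s = (y, μ) ∈ S`).
`𝒞′ = fderiv ℂ Cmap X₀`; `ℜ = 𝒞′ ∘ H`; KERNELS ARE COLUMNS: the print's `ℜ(c, c′)`/`(I + ℜ)⁻¹(c, c′)` applied to `Y` ↦ `(ℜ(Y·e_{c′}))(c)`,
`((I + ℜ)⁻¹(Y·e_{c′}))(c)`; the pairing weights `(L^{j′}η)^{±d}` of (66) cancel in this column reading.  DISTANCES: `d(c₋, c′₋)` ↦ the block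
ℓ¹-distance `l1(z − z′)` (`B7Prop1Explicit.l1`, definitionally the `l1` of the tree's Lemma 2.1 files `B6Lemma21TwoScale`); `d(c₋, y)` for a
fine site `y` ↦ `l1(Lʲz − y)/Lʲ` (units of `Lʲη`).  THE INPUT [5] Thm 3.12 IN KERNEL FORM (hypothesis `hHker`): `‖(H(Y·e_{c″}))(s)‖ ≤
B₁·e^{−δ₀·l1(Lʲz″ − s₋)/Lʲ}·‖Y‖`; the norm form (46) `‖HX‖ ≤ B₀‖X‖` stays a separate hypothesis where invertibility of `I + ℜ` is used.
CONSTANTS: `θ := C₃(Lʲ)²·2ε·2d·B₁·e^{2dδ₀}` (kernel size of `ℜ`, the print's `9C₂B₀ε₃` — here obtained from (72) in pairing form and the count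
(141)/(142) rather than from the Cauchy bound (69)); `c₁ := d·c₀(δ₀, ½)ᵈ` (the row sum of Lemma 2.1 on ONE scale, `B6.c0`); `q := θc₁` (print's
`9C₂B₀ε₃dc₁(½)`).  Regime = `B11Eq72Concrete`'s (regular background, witness radius `b`, (145)/(155)), `j ≤ k`, `0 < δ₀`.

WHAT THIS FILE PROVES (theorems only; kernel, 0 sorry, standard axioms).
* §0 ℓ¹ bookkeeping (`l1_sub_comm`, `l1_triangle` = [3] (2.54), `l1_loK_sub_loK`, **`l1_loK_sub_le_of_bondIn`** (the box `Bʲ(c₋) ∪ Bʲ(c₊)` lies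
  within `2dLʲ` of `c₋`), `scaled_triangle`/`scaled_triangle'`), **`rowSum_T`** (Lemma 2.1 [3] for the coarse bonds of one scale:
  `Σ_{c″∈T} e^{−½δ₀l1(z − z″)} ≤ d·c₀(δ₀,½)ᵈ`, `singleScale_row_sum` direction by direction), **`profile_contraction`** (a kernel `≤ θe^{−δ₀l1}`
  maps a profile `M·wt` to `θc₁M·wt` for weights losing at most `e^{−½δ₀l1}`) and **`decay_of_fixedPoint`** (`v = src − Rv` ⇒ `‖v‖ ≤ (1 − q)⁻¹A·wt`:
  the Neumann bound (71) as a maximum principle on the finite index set).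
* §1 **(69) AT KERNEL LEVEL, CONCRETE** `ineq69_kernel`: `‖(ℜw)(c)‖ ≤ θ·Σ_{c″} e^{−δ₀l1(z − z″)}‖w(c″)‖` for every `w ∈ 𝔸^T` at `‖X₀‖ ≤ 2ε`.
* §2 **(71) CONCRETE** `ineq71_kernel` (every solution `u` of `(I + ℜ)u = Y·e_{c′}` obeys `‖u(c)‖ ≤ (1 − q)⁻¹e^{−½δ₀l1(z − z′)}‖Y‖`, `q < 1`),
  **`ineq71_inverse`** (the same for `u = (I + ℜ)⁻¹(Y·e_{c′})`, `I + ℜ` invertible by `B11Eq70Concrete.isInvertible_one_add_R`), `ineq71_two`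
  (the second member: factor `2` for `q ≤ ½`).
NOT CLAIMED: the kernel bound of `H` itself ([5] Thm 3.12 — hypothesis), the multi-scale version (`j(c)` varying over `𝔅_k`; here ONE `Λ_j`),
the Euclidean/sup form of [3]'s distance (ℓ¹ as in the tree's Lemma 2.1 files), (73) (sequel file).  NOT summit progress.
-/

noncomputable section

open scoped BigOperators Topology
open NormedSpace Finset Metric Filter

namespace Literature.MathematicalPhysics.QuantumFieldTheory.Balaban1983to89.B11Eq71KernelConcrete

open B7Prop1Explicit B7Prop1Local B7Prop2Explicit B7Prop3Flat B7Prop4Flat B7Eq92Concrete B7Prop3GeneralLinear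
  B7Prop4GeneralLevels B7Prop5GeneralOperators B7Prop5GeneralInduction B7Prop5GeneralLevels B7Prop5General B7Ineq149Pairing
  B13Contraction113 B11Eq44Concrete B12SecondOrder267Concrete B11Eq70Concrete B11Eq72Concrete
open B7Prop5Flat (BondIn)
open B6Lemma21TwoScale (singleScale_row_sum)

-- `Site` alone would resolve to the torus sites of `Setup.lean`; re-export the `ℤ^d` sites of `B7Prop1Explicit`.
export B7Prop1Explicit (Site)

variable {d : ℕ}

/-! ## §0 ℓ¹ bookkeeping, the row sum of Lemma 2.1 [3] on one scale, profile contraction, fixed-point decay -/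

section Geometry

/-- `l1` (`B7Prop1Explicit.l1`, the ℓ¹ length on `ℤᵈ`; definitionally the `l1` of `B6Lemma21TwoScale`) is symmetric. [folklore] -/
private theorem l1_sub_comm (a b : Site d) : l1 (a - b) = l1 (b - a) := by
  rw [← neg_sub, l1_neg]

/-- triangle inequality for `l1`: `l1(a − c) ≤ l1(a − b) + l1(b − c)`. [folklore] -/
private theorem l1_triangle (a b c : Site d) : l1 (a - c) ≤ l1 (a - b) + l1 (b - c) := by
  have h := l1_add_le (a - b) (b - c)
  rwa [sub_add_sub_cancel] at h

/-- scaling: `l1(Lʲz − Lʲz′) = Lʲ·l1(z − z′)` for the block corners `loK`. [folklore] -/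
private theorem l1_loK_sub_loK (L j : ℕ) (z z' : Site d) : l1 (loK L j z - loK L j z') = L ^ j * l1 (z - z') := by
  unfold l1
  rw [Finset.mul_sum]
  refine Finset.sum_congr rfl fun i _ => ?_
  rw [Pi.sub_apply, Pi.sub_apply]
  simp only [loK]
  rw [← mul_sub, Int.natAbs_mul, Int.natAbs_pow]
  simp

/-- the box `Bʲ(c₋) ∪ Bʲ(c₊)` of [4] (141) is within ℓ¹-distance `2dLʲ` of its corner: `BondIn (loK z) (bondHiK z κ) y μ → l1(Lʲz − y) ≤ 2dLʲ`
(the geometric fact behind «b ∈ Bʲ(y)» in (73)). [cite: Balaban1985Averaging, (141) p.39] [cite: Balaban1985Variational, (73) p.289] -/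
theorem l1_loK_sub_le_of_bondIn {L j : ℕ} {z y : Site d} {κ μ : Fin d} (h : BondIn (loK L j z) (bondHiK L j z κ) y μ) :
    (l1 (loK L j z - y) : ℝ) ≤ 2 * d * (L : ℝ) ^ j := by
  have hbox := h.1
  have hcoord : ∀ i, ((loK L j z - y) i).natAbs ≤ 2 * L ^ j := by
    intro i
    have h1 := (hbox i).1
    have h2 := (hbox i).2
    simp only [loK, bondHiK] at h1 h2
    have hP : (0 : ℤ) ≤ (L : ℤ) ^ j := by positivity
    have hz : (((loK L j z - y) i).natAbs : ℤ) ≤ 2 * (L : ℤ) ^ j := by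
      rw [Int.natCast_natAbs, Pi.sub_apply]
      simp only [loK]
      rw [abs_le]
      constructor <;> split_ifs at h2 <;> linarith
    exact_mod_cast hz
  have hsum : l1 (loK L j z - y) ≤ d * (2 * L ^ j) := by
    unfold l1
    calc ∑ i, ((loK L j z - y) i).natAbs ≤ ∑ _i : Fin d, 2 * L ^ j := Finset.sum_le_sum fun i _ => hcoord i
      _ = d * (2 * L ^ j) := by simp
  have : (l1 (loK L j z - y) : ℝ) ≤ ((d * (2 * L ^ j) : ℕ) : ℝ) := by exact_mod_cast hsum
  refine this.trans (le_of_eq ?_)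
  push_cast
  ring

/-- the scaled triangle inequality between a fine site and two block corners: `l1(Lʲz − y)/Lʲ ≤ l1(z − z″) + l1(Lʲz″ − y)/Lʲ` — «This is of course
the triangle inequality for our distance» ([3] (2.54)). [cite: Balaban1984PropagatorsII, (2.54) p.233] -/
theorem scaled_triangle {L : ℕ} (hL : 1 ≤ L) (j : ℕ) (z z'' y : Site d) :
    (l1 (loK L j z - y) : ℝ) / (L : ℝ) ^ j ≤ (l1 (z - z'') : ℝ) + (l1 (loK L j z'' - y) : ℝ) / (L : ℝ) ^ j := by
  have hLj : (0 : ℝ) < (L : ℝ) ^ j := by positivity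
  have h := l1_triangle (loK L j z) (loK L j z'') y
  rw [l1_loK_sub_loK] at h
  have h' : (l1 (loK L j z - y) : ℝ) ≤ ((L ^ j * l1 (z - z'') + l1 (loK L j z'' - y) : ℕ) : ℝ) := by exact_mod_cast h
  push_cast at h'
  rw [div_le_iff₀ hLj, add_mul, div_mul_cancel₀ _ hLj.ne']
  linarith [mul_comm ((L : ℝ) ^ j) (l1 (z - z'') : ℝ)]

/-- and the reverse reading used for `H`'s columns: `l1(z − z″) − l1(Lʲz − y)/Lʲ ≤ l1(Lʲz″ − y)/Lʲ`. [folklore] -/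
private theorem scaled_triangle' {L : ℕ} (hL : 1 ≤ L) (j : ℕ) (z z'' y : Site d) :
    (l1 (z - z'') : ℝ) - (l1 (loK L j z - y) : ℝ) / (L : ℝ) ^ j ≤ (l1 (loK L j z'' - y) : ℝ) / (L : ℝ) ^ j := by
  have hLj : (0 : ℝ) < (L : ℝ) ^ j := by positivity
  have h := l1_triangle (loK L j z'') y (loK L j z)
  rw [l1_loK_sub_loK, l1_sub_comm z'' z, l1_sub_comm y (loK L j z)] at h
  have h' : ((L ^ j * l1 (z - z'') : ℕ) : ℝ) ≤ ((l1 (loK L j z'' - y) + l1 (loK L j z - y) : ℕ) : ℝ) := by exact_mod_cast h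
  push_cast at h'
  rw [sub_le_iff_le_add, ← add_div, le_div_iff₀ hLj]
  linarith [mul_comm ((L : ℝ) ^ j) (l1 (z - z'') : ℝ)]

/-- **LEMMA 2.1 [3] ON ONE SCALE — the row sum over the coarse bonds**: `Σ_{c″∈T} e^{−½δ₀·l1(z − z″)} ≤ d·c₀(δ₀, ½)ᵈ` for every `z ∈ ℤᵈ`
and every finite set `T` of coarse bonds (`B6Lemma21TwoScale.singleScale_row_sum` in each of the `d` directions: on the bonds of one direction
`c″ ↦ z − z″` is injective). [cite: Balaban1984PropagatorsII, Lemma 2.1 (2.61) p.234] [cite: Balaban1985Variational, (71) p.289] -/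
theorem rowSum_T (T : Finset (Site d × Fin d)) {δ₀ : ℝ} (hδ₀ : 0 < δ₀) (z : Site d) :
    ∑ c'' : T, Real.exp (-(1 / 2 * δ₀ * (l1 (z - c''.1.1) : ℝ))) ≤ d * B6.c0 δ₀ (1 / 2) ^ d := by
  classical
  have hα : (0 : ℝ) < 1 / 2 * δ₀ := by positivity
  have hfib : ∀ κ : Fin d, ∑ p ∈ T with p.2 = κ, Real.exp (-(1 / 2 * δ₀ * (l1 (z - p.1) : ℝ))) ≤ B6.c0 δ₀ (1 / 2) ^ d := by
    intro κ
    have hinj : Set.InjOn (fun p : Site d × Fin d => z - p.1) ↑(T.filter fun p => p.2 = κ) := by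
      intro p hp p' hp' hpp'
      rw [Finset.coe_filter] at hp hp'
      have h1 : p.1 = p'.1 := sub_right_injective hpp'
      exact Prod.ext h1 (hp.2.trans hp'.2.symm)
    have h := singleScale_row_sum hα (T.filter fun p => p.2 = κ) (fun p : Site d × Fin d => z - p.1) hinj
      (fun p => (l1 (z - p.1) : ℝ)) (fun p _ => le_of_eq rfl)
    exact h
  calc ∑ c'' : T, Real.exp (-(1 / 2 * δ₀ * (l1 (z - c''.1.1) : ℝ)))
      = ∑ p ∈ T, Real.exp (-(1 / 2 * δ₀ * (l1 (z - p.1) : ℝ))) :=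
        Finset.sum_coe_sort T (fun p : Site d × Fin d => Real.exp (-(1 / 2 * δ₀ * (l1 (z - p.1) : ℝ))))
    _ = ∑ κ : Fin d, ∑ p ∈ T with p.2 = κ, Real.exp (-(1 / 2 * δ₀ * (l1 (z - p.1) : ℝ))) :=
        (Finset.sum_fiberwise T Prod.snd _).symm
    _ ≤ ∑ _κ : Fin d, B6.c0 δ₀ (1 / 2) ^ d := Finset.sum_le_sum fun κ _ => hfib κ
    _ = d * B6.c0 δ₀ (1 / 2) ^ d := by simp

end Geometry

section Generic

variable {ι F : Type*} [Fintype ι] [NormedAddCommGroup F]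

/-- **PROFILE CONTRACTION** (the mechanism of «(71) … follows from Lemma 2.1 [3]»): if `R` has a kernel bounded by `θe^{−δ₀l1(z − z″)}`, the
row sum at half rate is `≤ c₁`, and the weight `wt` loses at most `e^{−½δ₀l1(z − z″)}` between `z″` and `z` ((2.54) of [3]), then a profile
`‖v(c″)‖ ≤ M·wt(c″)` is mapped to `‖(Rv)(c)‖ ≤ θc₁M·wt(c)` (split `e^{−δ₀l1} = e^{−½δ₀l1}·e^{−½δ₀l1}`).
[cite: Balaban1985Variational, (71) p.289] [cite: Balaban1984PropagatorsII, (2.54) p.233, Lemma 2.1 p.234] -/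
theorem profile_contraction (pos : ι → Site d) {θ δ₀ c₁ : ℝ} (hθ : 0 ≤ θ) {R : (ι → F) → (ι → F)}
    (hR : ∀ (w : ι → F) (i : ι), ‖R w i‖ ≤ θ * ∑ i'' : ι, Real.exp (-(δ₀ * (l1 (pos i - pos i'') : ℝ))) * ‖w i''‖)
    (hrow : ∀ i : ι, ∑ i'' : ι, Real.exp (-(1 / 2 * δ₀ * (l1 (pos i - pos i'') : ℝ))) ≤ c₁)
    {wt : ι → ℝ} (hwt0 : ∀ i, 0 ≤ wt i)
    (hwt : ∀ i i'' : ι, Real.exp (-(1 / 2 * δ₀ * (l1 (pos i - pos i'') : ℝ))) * wt i'' ≤ wt i)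
    {M : ℝ} (hM : 0 ≤ M) {v : ι → F} (hv : ∀ i, ‖v i‖ ≤ M * wt i) (i : ι) :
    ‖R v i‖ ≤ θ * c₁ * M * wt i := by
  have hterm : ∀ i'' : ι, Real.exp (-(δ₀ * (l1 (pos i - pos i'') : ℝ))) * ‖v i''‖ ≤
      M * wt i * Real.exp (-(1 / 2 * δ₀ * (l1 (pos i - pos i'') : ℝ))) := by
    intro i''
    have hsplit : Real.exp (-(δ₀ * (l1 (pos i - pos i'') : ℝ))) =
        Real.exp (-(1 / 2 * δ₀ * (l1 (pos i - pos i'') : ℝ))) * Real.exp (-(1 / 2 * δ₀ * (l1 (pos i - pos i'') : ℝ))) := by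
      rw [← Real.exp_add]; congr 1; ring
    calc Real.exp (-(δ₀ * (l1 (pos i - pos i'') : ℝ))) * ‖v i''‖
        ≤ Real.exp (-(δ₀ * (l1 (pos i - pos i'') : ℝ))) * (M * wt i'') :=
          mul_le_mul_of_nonneg_left (hv i'') (Real.exp_nonneg _)
      _ = M * Real.exp (-(1 / 2 * δ₀ * (l1 (pos i - pos i'') : ℝ))) *
            (Real.exp (-(1 / 2 * δ₀ * (l1 (pos i - pos i'') : ℝ))) * wt i'') := by rw [hsplit]; ring
      _ ≤ M * Real.exp (-(1 / 2 * δ₀ * (l1 (pos i - pos i'') : ℝ))) * wt i :=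
          mul_le_mul_of_nonneg_left (hwt i i'') (mul_nonneg hM (Real.exp_nonneg _))
      _ = M * wt i * Real.exp (-(1 / 2 * δ₀ * (l1 (pos i - pos i'') : ℝ))) := by ring
  calc ‖R v i‖ ≤ θ * ∑ i'' : ι, Real.exp (-(δ₀ * (l1 (pos i - pos i'') : ℝ))) * ‖v i''‖ := hR v i
    _ ≤ θ * ∑ i'' : ι, M * wt i * Real.exp (-(1 / 2 * δ₀ * (l1 (pos i - pos i'') : ℝ))) :=
        mul_le_mul_of_nonneg_left (Finset.sum_le_sum fun i'' _ => hterm i'') hθ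
    _ = θ * (M * wt i) * ∑ i'' : ι, Real.exp (-(1 / 2 * δ₀ * (l1 (pos i - pos i'') : ℝ))) := by
        rw [← Finset.mul_sum]; ring
    _ ≤ θ * (M * wt i) * c₁ := mul_le_mul_of_nonneg_left (hrow i) (mul_nonneg hθ (mul_nonneg hM (hwt0 i)))
    _ = θ * c₁ * M * wt i := by ring

/-- **DECAY OF THE SOLUTION OF `v = src − Rv`** (the Neumann-series bound (71) as a maximum principle on the finite index set): if the
source has the profile `‖src(c)‖ ≤ A·wt(c)` and `R` contracts profiles by the factor `q < 1`, then `‖v(c)‖ ≤ (1 − q)⁻¹A·wt(c)` — compare the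
printed `(1 − 9C₂B₀ε₃dc₁(½))⁻¹`. [cite: Balaban1985Variational, (71) p.289] -/
theorem decay_of_fixedPoint {wt : ι → ℝ} (hwt : ∀ i, 0 < wt i) {v src Rv : ι → F} {q A : ℝ} (hq : q < 1)
    (heq : ∀ i, v i = src i - Rv i) (hsrc : ∀ i, ‖src i‖ ≤ A * wt i)
    (hR : ∀ M : ℝ, 0 ≤ M → (∀ i, ‖v i‖ ≤ M * wt i) → ∀ i, ‖Rv i‖ ≤ q * M * wt i) (i : ι) :
    ‖v i‖ ≤ (1 - q)⁻¹ * A * wt i := by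
  classical
  have hne : (Finset.univ : Finset ι).Nonempty := ⟨i, Finset.mem_univ i⟩
  obtain ⟨i₀, -, hi₀⟩ := Finset.exists_max_image Finset.univ (fun i : ι => ‖v i‖ / wt i) hne
  set M : ℝ := ‖v i₀‖ / wt i₀ with hMdef
  have hM0 : 0 ≤ M := div_nonneg (norm_nonneg _) (hwt i₀).le
  have hvM : ∀ i', ‖v i'‖ ≤ M * wt i' := fun i' => by
    have h := hi₀ i' (Finset.mem_univ i')
    rwa [div_le_iff₀ (hwt i')] at h
  have hA : 0 ≤ A := by
    by_contra hA'
    have h := (norm_nonneg _).trans (hsrc i₀)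
    have h' : A * wt i₀ < 0 := mul_neg_of_neg_of_pos (lt_of_not_ge hA') (hwt i₀)
    linarith
  have hkey : M * wt i₀ ≤ (A + q * M) * wt i₀ := by
    have h1 : M * wt i₀ = ‖v i₀‖ := by rw [hMdef, div_mul_cancel₀ _ (hwt i₀).ne']
    rw [h1, heq i₀, add_mul]
    exact (norm_sub_le _ _).trans (add_le_add (hsrc i₀) (hR M hM0 hvM i₀))
  have hM' : M ≤ A + q * M := le_of_mul_le_mul_right hkey (hwt i₀)
  have hMle : M ≤ (1 - q)⁻¹ * A := by
    rw [inv_mul_eq_div, le_div_iff₀ (by linarith)]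
    nlinarith
  calc ‖v i‖ ≤ M * wt i := hvM i
    _ ≤ (1 - q)⁻¹ * A * wt i := mul_le_mul_of_nonneg_right hMle (hwt i).le

end Generic
/-! ## §1–§2 The concrete `ℜ = 𝒞′H`: (69) at kernel level, (71) -/

section Regime

variable {𝔸 : Type*} [NormedRing 𝔸] [NormedAlgebra ℂ 𝔸] [CompleteSpace 𝔸] [NormOneClass 𝔸]

variable (L : ℕ) (hL : 2 ≤ L) {G : Subgroup 𝔸ˣ} (hG : AvgClosed d L G) (k : ℕ)
  (U₀ : Site d → Fin d → 𝔸ˣ) (hU₀ : ∀ x κ, U₀ x κ ∈ G) {α₀ : ℝ} (hα : 0 < α₀)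
  (hα3 : C0 d * α₀ ≤ 1 / 3) (hα4 : 4 * α₀ ≤ c2' d L) (h52 : pdev U₀ < α₀ * (((L : ℝ) ^ k)⁻¹) ^ 2)
  {b : ℝ} (hb : 0 < b)
  (hsmall : Real.exp (4 * (800 * ((d : ℝ) + 1) ^ 2 * ((d : ℝ) + 4)) * α₀)
    * (1 + 8 * (131072 * ((d : ℝ) + 1) ^ 2) * ((L : ℝ) ^ k * b)) ≤ 2)
  (hc₃ : 4 * ((L : ℝ) ^ k * b) < c3 d L)
  (h145 : 8 * d * thetaGen d L α₀ * (L : ℝ)⁻¹ ^ 4 ≤ 1)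
  (h155 : (2 * (L : ℝ) - 1) * (L : ℝ)⁻¹ ^ 2 + 2 * d * thetaGen d L α₀ * (L : ℝ)⁻¹ ^ 3
    + 1 / 8 * (1 + 2 * d * thetaGen d L α₀ * (L : ℝ)⁻¹ ^ 2 + 2 * d * C3Gen d L * ((L : ℝ) ^ k * b)) * (L : ℝ)⁻¹ ^ 2 ≤ 1)
  (S T : Finset (Site d × Fin d)) (H : (T → 𝔸) →L[ℂ] (S → 𝔸)) {B₀ B₁ δ₀ ε : ℝ}

include hL hG hU₀ hα hα3 hα4 h52 hb hsmall hc₃ h145 h155 in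
/-- **(69) AT KERNEL LEVEL FOR THE CONCRETE `ℜ = 𝒞′H`** — «the operator in the square brackets … is of the same type as the operators R studied in
[3, 5]»: at `‖X₀‖ ≤ 2ε` (`2ε ≤ b`), if the kernel of `H` decays as `‖(H(Y·e_{c″}))(s)‖ ≤ B₁e^{−δ₀·l1(Lʲz″ − s₋)/Lʲ}‖Y‖` ([5] Thm 3.12), then for
every `w ∈ 𝔸^T` and every coarse bond `c = (z, κ)`: `‖(𝒞′(Hw))(c)‖ ≤ θ·Σ_{c″} e^{−δ₀l1(z − z″)}‖w(c″)‖`, `θ = C₃(Lʲ)²·2ε·2d·B₁·e^{2dδ₀}` —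
(72) in the pairing form (`B11Eq72Concrete.ineq72_concrete_pairing`), the locality weight `kerQdd` of [4] (141) living on `Bʲ(c₋) ∪ Bʲ(c₊)`
(within `2dLʲ` of `c₋`), and the count `Σ_s kerQdd(c, s) ≤ 2d`. [cite: Balaban1985Variational, (69) p.288, (72) p.289]
[cite: Balaban1985Averaging, (141)–(142) p.39, (149) p.40] -/
theorem ineq69_kernel {j : ℕ} (hj : j ≤ k) (hε0 : 0 < ε) (hε : 2 * ε ≤ b) {X₀ : S → 𝔸} (hX₀ : ‖X₀‖ ≤ 2 * ε)
    (hδ₀ : 0 ≤ δ₀) (hB₁ : 0 ≤ B₁)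
    (hHker : ∀ (c'' : T) (Y : 𝔸) (s : S),
      ‖H (Pi.single c'' Y) s‖ ≤ B₁ * Real.exp (-(δ₀ * ((l1 (loK L j c''.1.1 - s.1.1) : ℝ) / (L : ℝ) ^ j))) * ‖Y‖)
    (w : T → 𝔸) (c : T) :
    ‖fderiv ℂ (Cmap L U₀ S T j) X₀ (H w) c‖ ≤
      (C3Gen d L * (((L : ℝ) ^ j) ^ 2 * (2 * ε)) * (2 * d) * B₁ * Real.exp (2 * d * δ₀)) *
        ∑ c'' : T, Real.exp (-(δ₀ * (l1 (c.1.1 - c''.1.1) : ℝ))) * ‖w c''‖ := by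
  classical
  have hL1 : 1 ≤ L := le_trans (by norm_num) hL
  have hC3 : 0 ≤ C3Gen d L := by unfold C3Gen C1ppGen; positivity
  -- (72) in pairing form at `X₀`
  have h72 := ineq72_concrete_pairing L hL hG k U₀ hU₀ hα hα3 hα4 h52 hb hsmall hc₃ h145 h155 S T hj hε0 hε hX₀ (H w) c
  -- the columns of `H`: `(Hw)(s) = Σ_{c″} (H(w(c″)·e_{c″}))(s)`
  set sW : ℝ := ∑ c'' : T, Real.exp (-(δ₀ * (l1 (c.1.1 - c''.1.1) : ℝ))) * ‖w c''‖ with hsW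
  have hsW0 : 0 ≤ sW := Finset.sum_nonneg fun c'' _ => mul_nonneg (Real.exp_nonneg _) (norm_nonneg _)
  have hHw : ∀ s : S, ‖H w s‖ ≤ ∑ c'' : T, B₁ * Real.exp (-(δ₀ * ((l1 (loK L j c''.1.1 - s.1.1) : ℝ) / (L : ℝ) ^ j))) * ‖w c''‖ := by
    intro s
    have hdec : H w = ∑ c'' : T, H (Pi.single c'' (w c'')) := by
      conv_lhs => rw [← Finset.univ_sum_single w]
      rw [map_sum]
    rw [hdec, Finset.sum_apply]
    exact (norm_sum_le _ _).trans (Finset.sum_le_sum fun c'' _ => hHker c'' (w c'') s)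
  -- on the box of `c` the columns of `H` are bounded by the block-level profile
  have hloc : ∀ s : S, kerQdd L j c.1.1 c.1.2 s.1.1 s.1.2 * ‖H w s‖ ≤
      kerQdd L j c.1.1 c.1.2 s.1.1 s.1.2 * (B₁ * Real.exp (2 * d * δ₀) * sW) := by
    intro s
    by_cases hin : BondIn (loK L j c.1.1) (bondHiK L j c.1.1 c.1.2) s.1.1 s.1.2
    · refine mul_le_mul_of_nonneg_left ((hHw s).trans ?_) (kerQdd_nonneg L j _ _ _ _)
      rw [hsW, Finset.mul_sum]
      refine Finset.sum_le_sum fun c'' _ => ?_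
      have hbox := l1_loK_sub_le_of_bondIn hin
      have htri := scaled_triangle' hL1 j c.1.1 c''.1.1 s.1.1
      have hLj : (0 : ℝ) < (L : ℝ) ^ j := by positivity
      have hD : (l1 (c.1.1 - c''.1.1) : ℝ) - 2 * d ≤ (l1 (loK L j c''.1.1 - s.1.1) : ℝ) / (L : ℝ) ^ j := by
        have h2d : (l1 (loK L j c.1.1 - s.1.1) : ℝ) / (L : ℝ) ^ j ≤ 2 * d := by
          rw [div_le_iff₀ hLj]; exact hbox
        linarith
      have hexp : Real.exp (-(δ₀ * ((l1 (loK L j c''.1.1 - s.1.1) : ℝ) / (L : ℝ) ^ j))) ≤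
          Real.exp (2 * d * δ₀) * Real.exp (-(δ₀ * (l1 (c.1.1 - c''.1.1) : ℝ))) := by
        rw [← Real.exp_add]
        exact Real.exp_le_exp.2 (by nlinarith)
      calc B₁ * Real.exp (-(δ₀ * ((l1 (loK L j c''.1.1 - s.1.1) : ℝ) / (L : ℝ) ^ j))) * ‖w c''‖
          ≤ B₁ * (Real.exp (2 * d * δ₀) * Real.exp (-(δ₀ * (l1 (c.1.1 - c''.1.1) : ℝ)))) * ‖w c''‖ :=
            mul_le_mul_of_nonneg_right (mul_le_mul_of_nonneg_left hexp hB₁) (norm_nonneg _)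
        _ = B₁ * Real.exp (2 * d * δ₀) * (Real.exp (-(δ₀ * (l1 (c.1.1 - c''.1.1) : ℝ))) * ‖w c''‖) := by ring
    · rw [kerQdd_of_not_bondIn hin, zero_mul, zero_mul]
  have hsum : ∑ s : S, kerQdd L j c.1.1 c.1.2 s.1.1 s.1.2 * ‖H w s‖ ≤ 2 * d * (B₁ * Real.exp (2 * d * δ₀) * sW) := by
    calc ∑ s : S, kerQdd L j c.1.1 c.1.2 s.1.1 s.1.2 * ‖H w s‖
        ≤ ∑ s : S, kerQdd L j c.1.1 c.1.2 s.1.1 s.1.2 * (B₁ * Real.exp (2 * d * δ₀) * sW) := Finset.sum_le_sum fun s _ => hloc s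
      _ = (∑ s : S, kerQdd L j c.1.1 c.1.2 s.1.1 s.1.2) * (B₁ * Real.exp (2 * d * δ₀) * sW) := by rw [Finset.sum_mul]
      _ ≤ 2 * d * (B₁ * Real.exp (2 * d * δ₀) * sW) :=
          mul_le_mul_of_nonneg_right (sum_kerQdd_le S L hL1 j c.1.1 c.1.2) (by positivity)
  calc ‖fderiv ℂ (Cmap L U₀ S T j) X₀ (H w) c‖
      ≤ C3Gen d L * (((L : ℝ) ^ j) ^ 2 * (2 * ε)) * ∑ s : S, kerQdd L j c.1.1 c.1.2 s.1.1 s.1.2 * ‖H w s‖ := h72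
    _ ≤ C3Gen d L * (((L : ℝ) ^ j) ^ 2 * (2 * ε)) * (2 * d * (B₁ * Real.exp (2 * d * δ₀) * sW)) :=
        mul_le_mul_of_nonneg_left hsum (by positivity)
    _ = (C3Gen d L * (((L : ℝ) ^ j) ^ 2 * (2 * ε)) * (2 * d) * B₁ * Real.exp (2 * d * δ₀)) * sW := by ring

include hL hG hU₀ hα hα3 hα4 h52 hb hsmall hc₃ h145 h155 in
/-- **(71) CONCRETE — THE KERNEL OF `(I + ℜ)⁻¹` DECAYS**: with `θ` as in `ineq69_kernel`, `c₁ = d·c₀(δ₀,½)ᵈ` (Lemma 2.1 [3], `rowSum_T`) and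
`q = θc₁ < 1` («for ε₃ sufficiently small»), every solution `u ∈ 𝔸^T` of the column equation `(I + ℜ)u = Y·e_{c′}` satisfies
`‖u(c)‖ ≤ (1 − q)⁻¹·e^{−½δ₀l1(z − z′)}·‖Y‖` — «|(I + ℜ)⁻¹(c, c′)| ≦ (1 − 9C₂B₀ε₃dc₁(½))⁻¹(L^{j′}η)^{−d}e^{−(1/2)δ₀d(c₋,c′₋)} … which follows from
Lemma 2.1 [3]» (the pairing weight `(L^{j′}η)^{−d}` cancels in the column reading). [cite: Balaban1985Variational, (71) p.289]
[cite: Balaban1984PropagatorsII, Lemma 2.1 p.234] -/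
theorem ineq71_kernel {j : ℕ} (hj : j ≤ k) (hε0 : 0 < ε) (hε : 2 * ε ≤ b) {X₀ : S → 𝔸} (hX₀ : ‖X₀‖ ≤ 2 * ε)
    (hδ₀ : 0 < δ₀) (hB₁ : 0 ≤ B₁)
    (hHker : ∀ (c'' : T) (Y : 𝔸) (s : S),
      ‖H (Pi.single c'' Y) s‖ ≤ B₁ * Real.exp (-(δ₀ * ((l1 (loK L j c''.1.1 - s.1.1) : ℝ) / (L : ℝ) ^ j))) * ‖Y‖)
    (hq : (C3Gen d L * (((L : ℝ) ^ j) ^ 2 * (2 * ε)) * (2 * d) * B₁ * Real.exp (2 * d * δ₀)) * (d * B6.c0 δ₀ (1 / 2) ^ d) < 1)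
    (c' : T) (Y : 𝔸) {u : T → 𝔸} (hu : u + fderiv ℂ (Cmap L U₀ S T j) X₀ (H u) = Pi.single c' Y) (c : T) :
    ‖u c‖ ≤ (1 - (C3Gen d L * (((L : ℝ) ^ j) ^ 2 * (2 * ε)) * (2 * d) * B₁ * Real.exp (2 * d * δ₀)) * (d * B6.c0 δ₀ (1 / 2) ^ d))⁻¹ *
      Real.exp (-(1 / 2 * δ₀ * (l1 (c.1.1 - c'.1.1) : ℝ))) * ‖Y‖ := by
  classical
  have hC3 : 0 ≤ C3Gen d L := by unfold C3Gen C1ppGen; positivity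
  set θ : ℝ := C3Gen d L * (((L : ℝ) ^ j) ^ 2 * (2 * ε)) * (2 * d) * B₁ * Real.exp (2 * d * δ₀) with hθ
  have hθ0 : 0 ≤ θ := by positivity
  -- the weight `e^{−½δ₀ l1(z − z′)}` centred at `c′`
  have key := decay_of_fixedPoint (ι := T) (F := 𝔸)
    (wt := fun c : T => Real.exp (-(1 / 2 * δ₀ * (l1 (c.1.1 - c'.1.1) : ℝ)))) (fun c => Real.exp_pos _)
    (v := u) (src := Pi.single c' Y) (Rv := fderiv ℂ (Cmap L U₀ S T j) X₀ (H u))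
    (q := θ * (d * B6.c0 δ₀ (1 / 2) ^ d)) (A := ‖Y‖) hq
    (fun c => by rw [← hu]; simp)
    (fun c => by
      by_cases hc : c = c'
      · subst hc; simp [l1, Pi.single_eq_same]
      · rw [Pi.single_eq_of_ne hc, norm_zero]; positivity)
    (fun M hM hv c => by
      have h := profile_contraction (ι := T) (F := 𝔸) (fun c : T => c.1.1) hθ0
        (R := fun w => fderiv ℂ (Cmap L U₀ S T j) X₀ (H w))
        (fun w i => ineq69_kernel L hL hG k U₀ hU₀ hα hα3 hα4 h52 hb hsmall hc₃ h145 h155 S T H hj hε0 hε hX₀ hδ₀.le hB₁ hHker w i)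
        (fun i => rowSum_T T hδ₀ i.1.1) (wt := fun c : T => Real.exp (-(1 / 2 * δ₀ * (l1 (c.1.1 - c'.1.1) : ℝ))))
        (fun i => Real.exp_nonneg _)
        (fun i i'' => by
          rw [← Real.exp_add]
          refine Real.exp_le_exp.2 ?_
          have ht : (l1 (i.1.1 - c'.1.1) : ℝ) ≤ (l1 (i.1.1 - i''.1.1) : ℝ) + (l1 (i''.1.1 - c'.1.1) : ℝ) := by
            exact_mod_cast l1_triangle i.1.1 i''.1.1 c'.1.1
          nlinarith)
        hM hv c
      exact h)
    c
  refine key.trans (le_of_eq ?_)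
  ring

include hL hG hU₀ hα hα3 hα4 h52 hb hsmall hc₃ h145 h155 in
/-- **(71) FOR `(I + ℜ)⁻¹` ITSELF**: under (46) `‖HX‖ ≤ B₀‖X‖`, «9C₂B₀ε₃ < 1» and `3ε < b` the operator `I + ℜ` is invertible
(`B11Eq70Concrete.isInvertible_one_add_R`), and the columns of its inverse decay: `‖((I + ℜ)⁻¹(Y·e_{c′}))(c)‖ ≤ (1 − q)⁻¹e^{−½δ₀l1(z − z′)}‖Y‖`.
[cite: Balaban1985Variational, (71) p.289, (46) p.285] -/
theorem ineq71_inverse {j : ℕ} (hj : j ≤ k) (hB₀ : 0 ≤ B₀) (hH : ∀ X, ‖H X‖ ≤ B₀ * ‖X‖) (hε0 : 0 < ε) (hε3 : 3 * ε < b)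
    (hq9 : 9 * ((8 * (131072 * ((d : ℝ) + 1) ^ 2) * Real.exp (4 * (800 * ((d : ℝ) + 1) ^ 2 * ((d : ℝ) + 4)) * α₀))
      * ((L : ℝ) ^ j) ^ 2) * B₀ * ε < 1) {X₀ : S → 𝔸} (hX₀ : ‖X₀‖ ≤ 2 * ε)
    (hδ₀ : 0 < δ₀) (hB₁ : 0 ≤ B₁)
    (hHker : ∀ (c'' : T) (Y : 𝔸) (s : S),
      ‖H (Pi.single c'' Y) s‖ ≤ B₁ * Real.exp (-(δ₀ * ((l1 (loK L j c''.1.1 - s.1.1) : ℝ) / (L : ℝ) ^ j))) * ‖Y‖)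
    (hq : (C3Gen d L * (((L : ℝ) ^ j) ^ 2 * (2 * ε)) * (2 * d) * B₁ * Real.exp (2 * d * δ₀)) * (d * B6.c0 δ₀ (1 / 2) ^ d) < 1)
    (c' : T) (Y : 𝔸) (c : T) :
    ‖(1 + fderiv ℂ (Cmap L U₀ S T j) X₀ ∘L H).inverse (Pi.single c' Y) c‖ ≤
      (1 - (C3Gen d L * (((L : ℝ) ^ j) ^ 2 * (2 * ε)) * (2 * d) * B₁ * Real.exp (2 * d * δ₀)) * (d * B6.c0 δ₀ (1 / 2) ^ d))⁻¹ *
        Real.exp (-(1 / 2 * δ₀ * (l1 (c.1.1 - c'.1.1) : ℝ))) * ‖Y‖ := by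
  have hinv := isInvertible_one_add_R L hL hG k U₀ hU₀ hα hα3 hα4 h52 hb hsmall hc₃ S T H hj hB₀ hH hε0 hε3 hq9 hX₀
  set u : T → 𝔸 := (1 + fderiv ℂ (Cmap L U₀ S T j) X₀ ∘L H).inverse (Pi.single c' Y) with hudef
  have hu : u + fderiv ℂ (Cmap L U₀ S T j) X₀ (H u) = Pi.single c' Y := by
    have h := hinv.self_apply_inverse (Pi.single c' Y)
    rw [← hudef] at h
    simpa using h
  exact ineq71_kernel L hL hG k U₀ hU₀ hα hα3 hα4 h52 hb hsmall hc₃ h145 h155 S T H hj hε0 (by linarith) hX₀ hδ₀ hB₁ hHker hq c' Y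
    hu c

include hL hG hU₀ hα hα3 hα4 h52 hb hsmall hc₃ h145 h155 in
/-- **(71), SECOND MEMBER**: for `q ≤ ½` («for ε₃ sufficiently small») the factor is `2`: `‖((I + ℜ)⁻¹(Y·e_{c′}))(c)‖ ≤ 2e^{−½δ₀l1(z − z′)}‖Y‖`.
[cite: Balaban1985Variational, (71) p.289] -/
theorem ineq71_two {j : ℕ} (hj : j ≤ k) (hB₀ : 0 ≤ B₀) (hH : ∀ X, ‖H X‖ ≤ B₀ * ‖X‖) (hε0 : 0 < ε) (hε3 : 3 * ε < b)
    (hq9 : 9 * ((8 * (131072 * ((d : ℝ) + 1) ^ 2) * Real.exp (4 * (800 * ((d : ℝ) + 1) ^ 2 * ((d : ℝ) + 4)) * α₀))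
      * ((L : ℝ) ^ j) ^ 2) * B₀ * ε < 1) {X₀ : S → 𝔸} (hX₀ : ‖X₀‖ ≤ 2 * ε)
    (hδ₀ : 0 < δ₀) (hB₁ : 0 ≤ B₁)
    (hHker : ∀ (c'' : T) (Y : 𝔸) (s : S),
      ‖H (Pi.single c'' Y) s‖ ≤ B₁ * Real.exp (-(δ₀ * ((l1 (loK L j c''.1.1 - s.1.1) : ℝ) / (L : ℝ) ^ j))) * ‖Y‖)
    (hq2 : (C3Gen d L * (((L : ℝ) ^ j) ^ 2 * (2 * ε)) * (2 * d) * B₁ * Real.exp (2 * d * δ₀)) * (d * B6.c0 δ₀ (1 / 2) ^ d) ≤ 1 / 2)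
    (c' : T) (Y : 𝔸) (c : T) :
    ‖(1 + fderiv ℂ (Cmap L U₀ S T j) X₀ ∘L H).inverse (Pi.single c' Y) c‖ ≤
      2 * Real.exp (-(1 / 2 * δ₀ * (l1 (c.1.1 - c'.1.1) : ℝ))) * ‖Y‖ := by
  have h := ineq71_inverse L hL hG k U₀ hU₀ hα hα3 hα4 h52 hb hsmall hc₃ h145 h155 S T H hj hB₀ hH hε0 hε3 hq9 hX₀ hδ₀ hB₁ hHker
    (by linarith) c' Y c
  refine h.trans (mul_le_mul_of_nonneg_right (mul_le_mul_of_nonneg_right ?_ (Real.exp_nonneg _)) (norm_nonneg _))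
  rw [inv_le_comm₀ (by linarith) (by norm_num : (0 : ℝ) < 2)]
  linarith

end Regime

end Literature.MathematicalPhysics.QuantumFieldTheory.Balaban1983to89.B11Eq71KernelConcrete

end
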